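import Mathlib
import Literature.Geometry.Lorentzian.AdmissibleDataLocality
import Literature.Geometry.Lorentzian.CauchyDevelopment
import Literature.Geometry.Lorentzian.Genericity
import Literature.Geometry.Lorentzian.LeviCivitaProofs
import HarnessLib

/-!
# LocalConstraintDeformation

Topic `Literature/Geometry/Lorentzian`. Named literature fact(s) relocated by the gate from `Summits/FinalStateConjecture/FinalStateConjecture/Theorems/ZeroEnergyKerrOrBombStationaryLimitReductionMoncriefFactsWave3.lean`
(accept-time relocation of `[cite]`d propositions written inline in a Summits proposal; human ruling 2026-08-15).
Sources: ChruscielDelay2003, ChruscielDelay2004, CorvinoSchoen2006, Moncrief1975.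

* `Literature.Geometry.Lorentzian.ChruscielDelay_localConstraintDeformation`
-/

namespace Literature.Geometry.Lorentzian

open scoped Manifold ContDiff Topology BigOperators
open Set Filter Bundle MeasureTheory Literature.Geometry.Lorentzian

/-- **Chruściel–Delay / Corvino–Schoen local deformation of the vacuum constraints, with prescribed
compactly supported tangents, near a point free of Killing initial data** (named fact, D-0014;
stated inline over the Literature vocabulary of initial data sets, vacuum Cauchy developments and
jointly smooth families of data, for the `C^∞` data of the tree).

Printed sources. (1) P. T. Chruściel, E. Delay, Mém. SMF 94 (2003) = gr-qc/0301073, **Thm. 5.9**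
(compact manifold with boundary `M̄`, weights `φ = x²`, `ψ = e^{s/x}`: for `(K, g)` near `(K₀, g₀)`
and small `(δJ, δρ)` a solution `(δK, δg) = e^{−2s/x} Φ² P*(Y, N)` of the constraint equations
projected off the kernel `𝒦₀` of `P*` = the KIDs), **Prop. 5.10** (weighted Hölder regularity),
**Cor. 5.11** (smooth data and source ⇒ `(δK, δg) ∈ C^∞(M̄)`, "smoothly extended by zero across
`∂M`"). (2) P. T. Chruściel, E. Delay, J. Geom. Phys. 51 (2004) = gr-qc/0309001, **Thm. 6.6** with
Thm. 5.2, Rem. 5.10, **Cor. 5.11**: with these weights the KID-free vacuum data on `M̄` form an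
embedded `C^∞` Banach submanifold modelled on `ker P_{(K,g)}` (the constraint map is a submersion
off KIDs). (3) J. Corvino, R. Schoen, J. Differential Geom. 73 (2006) = gr-qc/0301071, **Thm. 2**:
the same local surjectivity on a compactly contained smooth domain `Ω ⊂ M³` whose linearised
constraint map has injective formal adjoint (no KIDs), solutions `= (g₀, π₀)` outside `Ω`, smooth
for smooth data with an exponential weight. (4) V. Moncrief, J. Math. Phys. 16 (1975) 493, §III:
the KIDs `(N, Y)` on an open subset `Ω` of a Cauchy hypersurface of a vacuum spacetime are exactly
the normal–tangential splittings `N ν + Y` on `Ω` of the Killing fields of the domain of dependence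
of `Ω` (as recalled in (2), §2).

What is vendored (hypothesis by hypothesis). `D = (h, k)` a smooth datum on a `3`-manifold `X`
solving the vacuum constraints; `𝒟` a vacuum Cauchy development of `D`, `ι` its embedding; `x₀ ∈ X`
such that for every connected open `V ∋ x₀` every vector field smooth and Killing on an open set of
`𝒟` containing `ι(V)` vanishes on `ι(V)` (⇔ by (4): no coordinate ball around `x₀` carries a
non-trivial KID). CONCLUSION: inside every open `V ∋ x₀` there is an open `U ∋ x₀` (a coordinate
ball `B`, `B̄ ⊂ V` compact) such that, for any `k` pairs `(aⱼ, bⱼ)` of fields of bilinear forms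
each of which is the fibrewise `s`-derivative at `0` of a jointly smooth one-parameter family of
data through `D`, equal to `D` off a compact `K ⊆ U`, along which the Hamiltonian and momentum
constraint functions are stationary at `s = 0` at every point (so `(bⱼ, aⱼ) ∈ ker P_{(k,h)}`,
smooth, supported in `K ⊂ B`: chain rule), there are `ε ≠ 0` and a jointly smooth `k`-parameter
family `G : ℝᵏ → data` of VACUUM data with `G 0 = D`, `G c = D` off one compact `K' ⊆ V` for all
`c`, and `∂G/∂cⱼ|₀ = ε (aⱼ, bⱼ)` fibrewise. Assembly of (1)–(4), each step routine but not printed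
verbatim: (i) `B` has no KIDs ((4) with `V := B`, the open set `int D(ι(B)) ⊇ ι(B)`); (ii) by (2)
the vacuum data on `B̄` agreeing with `D` to infinite order at `∂B` form near `D` a `C^∞` Banach
submanifold with tangent space `ker P ∋ (bⱼ, aⱼ)`, so composing a submanifold chart with
`c ↦ Σ cⱼ (bⱼ, aⱼ)` gives a smooth `k`-parameter family on a ball `N ∋ 0` with these tangents;
(iii) by (1) Cor. 5.11, interior elliptic regularity and uniqueness in the inverse function
theorem, the same family is smooth into every `C^{m,α}_{x²,e^{t/x}}(B̄)`, hence its extension by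
`D` off `B̄ =: K'` is jointly `C^∞` on `N × X` and positive definite for `N` small; (iv) the squash
`ℝᵏ → N`, `c ↦ ε c / √(1 + |c|²)`, reparametrises, scaling the tangents by `ε`. Nothing is claimed
at points carrying a local Killing germ, and admissibility (asymptotics) is neither assumed nor
concluded. [cite: ChruscielDelay2003, Thm. 5.9, Prop. 5.10, Cor. 5.11]
[cite: ChruscielDelay2004, Thm. 6.6 and Cor. 5.11] [cite: CorvinoSchoen2006, Thm. 2]
[cite: Moncrief1975, §III] [file Geometry/Lorentzian/LocalConstraintDeformation] -/
def ChruscielDelay_localConstraintDeformation : Prop :=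
  ∀ (X : Type) [TopologicalSpace X] [ChartedSpace E3 X] [IsManifold (𝓡 3) ∞ X]
    [T2Space X] [SecondCountableTopology X] [ConnectedSpace X]
    (D : InitialDataSet (𝓡 3) X) (𝒟 : VacuumCauchyDevelopment D) (x₀ : X),
    (∀ [D.metric.HasLeviCivita], D.IsVacuumConstraintSolution) →
    (haveI : 𝒟.metric.toPseudoRiemannianMetric.HasLeviCivita := 𝒟.metric.hasLeviCivita
      ∀ V : Set X, IsOpen V → IsConnected V → x₀ ∈ V →
        ∀ W : Set 𝒟.carrier, IsOpen W → 𝒟.embed '' V ⊆ W →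
          ∀ ξ : (p : 𝒟.carrier) → TangentSpace (𝓡 4) p,
            ContMDiffOn (𝓡 4) ((𝓡 4).prod 𝓘(ℝ, E4)) ∞
              (fun p ↦ (Bundle.TotalSpace.mk' E4 p (ξ p) : TangentBundle (𝓡 4) 𝒟.carrier)) W →
            (∀ p ∈ W, ∀ Y₀ Z₀ : TangentSpace (𝓡 4) p,
              𝒟.metric.val p (𝒟.metric.toPseudoRiemannianMetric.leviCivita ξ p Y₀) Z₀ +
                𝒟.metric.val p Y₀ (𝒟.metric.toPseudoRiemannianMetric.leviCivita ξ p Z₀) = 0) →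
            ∀ x ∈ V, ξ (𝒟.embed x) = 0) →
    ∀ V : Set X, IsOpen V → x₀ ∈ V →
      ∃ U : Set X, IsOpen U ∧ x₀ ∈ U ∧ U ⊆ V ∧
        ∀ (k : ℕ) (a b : Fin k → Π x : X, TangentSpace (𝓡 3) x →L[ℝ] TangentSpace (𝓡 3) x →L[ℝ] ℝ)
          (K : Set X), IsCompact K → K ⊆ U →
          (∀ j, ∃ F : EuclideanSpace ℝ (Fin 1) → InitialDataSet (𝓡 3) X,
            InitialDataSet.IsSmoothDataFamily 1 F ∧ F 0 = D ∧
            (∀ (c : EuclideanSpace ℝ (Fin 1)) (x : X), x ∉ K →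
              (F c).h.inner x = D.h.inner x ∧ (F c).k x = D.k x) ∧
            (fun x : X ↦ deriv (fun s : ℝ ↦ (show E3 →L[ℝ] E3 →L[ℝ] ℝ from
              (F (EuclideanSpace.single 0 s)).h.inner x)) 0) = a j ∧
            (fun x : X ↦ deriv (fun s : ℝ ↦ (show E3 →L[ℝ] E3 →L[ℝ] ℝ from
              (F (EuclideanSpace.single 0 s)).k x)) 0) = b j ∧
            ∀ x : X,
              HasDerivAt (fun s : ℝ ↦
                haveI := (F (EuclideanSpace.single 0 s)).metric.hasLeviCivita
                (F (EuclideanSpace.single 0 s)).hamiltonianConstraintFn x) 0 0 ∧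
              ∀ v : TangentSpace (𝓡 3) x,
                HasDerivAt (fun s : ℝ ↦
                  haveI := (F (EuclideanSpace.single 0 s)).metric.hasLeviCivita
                  (F (EuclideanSpace.single 0 s)).momentumConstraintFn x v) 0 0) →
          ∃ (G : EuclideanSpace ℝ (Fin k) → InitialDataSet (𝓡 3) X) (ε : ℝ), ε ≠ 0 ∧
            InitialDataSet.IsSmoothDataFamily k G ∧ G 0 = D ∧
            (∀ c, ∀ [(G c).metric.HasLeviCivita], (G c).IsVacuumConstraintSolution) ∧
            (∃ K' : Set X, IsCompact K' ∧ K' ⊆ V ∧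
              ∀ (c : EuclideanSpace ℝ (Fin k)) (x : X), x ∉ K' →
                (G c).h.inner x = D.h.inner x ∧ (G c).k x = D.k x) ∧
            ∀ j, (fun x : X ↦ deriv (fun s : ℝ ↦ (show E3 →L[ℝ] E3 →L[ℝ] ℝ from
                (G (EuclideanSpace.single j s)).h.inner x)) 0) = ε • a j ∧
              (fun x : X ↦ deriv (fun s : ℝ ↦ (show E3 →L[ℝ] E3 →L[ℝ] ℝ from
                (G (EuclideanSpace.single j s)).k x)) 0) = ε • b j

/-! ## §2 The bridge: fact (a) of the stub from the cited fact (registered helper) -/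

end Literature.Geometry.Lorentzian
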